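/-
Width seat `ym-line-cbag-p1-w3` (prover-ym-line-cbag-p1-w3-g8-0), the only seat left on LINE 3 `route-QuantumFields-SixPlaneColdBox`:
the CRUX `DensityTransferG` (stmt-QuantumFields-25709, rank 3) BY NAME from its two registered stubs (birth skeleton
`bc/DensityTransferG_birth.lean`, sha 248f43f0f52c, composition `densityTransferG_of`).
-/
import Summits.QuantumFields.YangMills.Theorems.SixPlaneColdBoxDensityTransferGSixPlaneTransferWithSlackG
import Summits.QuantumFields.YangMills.Theorems.SixPlaneColdBoxDensityTransferGSlackAbsorptionG

/-!
# Crux `DensityTransferG` (stmt-QuantumFields-25709): `TorusMeanNearColdBoxG → BulkDominatesBoxDensityG`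

The skeleton verbatim: `densityTransferG_proof := densityTransferG_of stub_sixPlaneTransferWithSlackG stub_slackAbsorptionG` — the
six-plane DLR transfer with slack given the torus-mean bound (stub 1, this seat) composed with slack absorption by the landed cold-box
floor (stub 2, w2's content).  With the route's `assembly_proof` (p1) and target item `BulkDominatesBoxDensityG`, LINE 3 is now
conditional on exactly ONE open crux, `TorusMeanNearColdBoxG` (stmt-QuantumFields-25708, the infrared input).

No sorry; standard axioms.  NOT the Yang–Mills mass gap: `SixPlaneColdBox` is a LINE onto the RECORD-type node `LatticeNonFreezing`;
no summit statement is touched.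
-/

set_option autoImplicit false

namespace Summit.QuantumFields.YangMills.Theorems.SixPlaneColdBox

/-- **Crux `DensityTransferG` of route `SixPlaneColdBox`:** the torus-mean bound `TorusMeanNearColdBoxG` implies the one-sided transfer
`BulkDominatesBoxDensityG` of the cold-box six-plane covariance floor to the torus (stub 1 ∘ stub 2 of the registered skeleton). -/
theorem densityTransferG_proof : Summit.QuantumFields.YangMills.Theses.SixPlaneColdBox.DensityTransferG :=
  densityTransferG_of stub_sixPlaneTransferWithSlackG stub_slackAbsorptionG

end Summit.QuantumFields.YangMills.Theorems.SixPlaneColdBox
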